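import Summits.QuantumFields.BalabanUV.Beta.D1BFx.PackedColumnJetMass
import Summits.QuantumFields.BalabanUV.Beta.D1BFx.PackedNSideReadout
import Summits.QuantumFields.BalabanUV.Beta.D1BFx.RestKernelSandwichLoc

/-!
# `BalabanUV.Beta.D1BFx.PackedRoadJetRows` — road «BF-x» for binder row D1, slot (K): **«JET ROWS AT THE ROAD, V HALF» — THE BLOCK-MASS LETTERS
# `hVs ∕ hVm` OF THE ROAD's PACKED FIRST JETS `vertexOfK G₀ (m+1) (SN m a (S (m+1)))` (the OWNER's PART 12b ∕ 13 `RoadEndBFxRoadS` ∕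
# `RoadEndBFxRoadGhostFreeS` display them, m-uniform, as HYPOTHESES) FROM TWO LETTERS ABOUT SIMPLER OBJECTS: the `σ`-weighted block masses of the
# LITERAL's first-derivative stencils `S (m+1) κ u` themselves (or its `LocStencil` socket + ONE units inequality), and the `σ`-weighted mass of the
# TB4-W co-frame first bond kernel `tBw₁ (m+1) a κ u` (ff block only) — through gan24-leaf-05's «G0-JET-MASS» `PackedColumnJetMass.mass_blk_vertexOfK_G₀_le`
# (power `n⁰`), BY NAME.**

HONEST DEPENDENCY (cell records, verbatim): «continuum YM on T⁴ ⇐ BetaPertH ∧ nine spine estimates (0/9 proved); BetaPertH ⇐ (D1) ∧ (D4) ∧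
CAP+tail; G-an2-4 gates asym, D1 and NE2/3/4.»  HONEST FRAMING (cell contract, verbatim): «discharging `BetaPertH` makes Bałaban's UV stability
UNCONDITIONAL — a real constructive-QFT result; it is NOT the continuum limit and NOT the Clay problem.»  THIS MODULE DISCHARGES NOTHING of the
wall: [folklore] `ℓ¹` bookkeeping — the four blocks of leaf-03's N-side stencil `SN m a S = twistR S + embFF (tBw₁ (m+1) a)` read off (`±` a block of `S`,
plus `tBw₁` in the ff block), the mass of a sum ∕ of a negated kernel, then gan24-leaf-05's lemma.  The m-UNIFORMITY of the two input letters is NOT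
proved here: the literal's letter is the (J1)∕`JcOf` data of another lineage (d1-p3 ∕ an2), and **the m-uniform `σ`-mass of `tBw₁ (m+1) a κ u` is an OPEN
(II)-row of the road — «TB4-W CO-FRAME FIRST JET, m-UNIFORM MASS» — the first-order twin of «TB4-W CO-FRAME TABLE, m-UNIFORM MASS» (OWNER W-d1p2-g19-5,
leaf-03 W-d1leaf03g24-3)**; per scale it is a theorem (§4, from `PackedCoframeWord.biLoc_tBw₁_rate`, constant NOT displayed ∕ NOT counted).  No definition,
no `def … : Prop`, no notation, nothing cited, 0 sorry.  0 root-level binders of row D1 discharged (hW ∕ hR-sockets ∕ hSX-socket ∕ D1Tel ∕ D1Rep — 0);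
(K) NOT closed; NOT D1, NOT `BetaPertH`, NOT continuum, NOT Clay.

ABSOLUTE RULE (cell charter, verbatim): «No internally-minted statement may enter as a cited fact. Every hypothesis is either kernel-proved in
this package or a verbatim quotation of a PUBLISHED theorem with page reference. The manuscript(s) under audit are NOT citable for their own
disputed steps — they are the thing under adjudication; programme-internal (2001/route/tribunal) claims are never citable.»

CONTENT (all [folklore] ∕ [our object] read-outs).
* §1 the blocks of `SN`: `blk_ft_SN` (`= blk S ft`), `blk_tf_SN` (`= −blk S tf`), `blk_ff_SN` (`= −blk S ff`) (leaf-03's `blk_tt_SN`: `= blk S tt + tBw₁`).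
* §2 `mass_integrand_neg`, **`mass_add_le`**; **`mass_blk_SN_le`**: the `σ`-weighted `u`-centred block masses of `SN m a S κ u` are
  `≤ mS j k + [j = k = tt]·mT` on the two letters.
* §3 **`road_jet_mass_le (m) (hr)`** (one scale, in gan24-leaf-05's currency) and **`road_jet_rows`** (the road's families `r n`, `S n`; EXACTLY 12b's
  `hVs`∕`hVm` integrands at every `m ≥ 1`, with `mV j k := 4·C_{G₀}·(1 + 16∕κ′)⁴·(mS j k + [tt]·mT)`) — Form A, on DISPLAYED m-uniform MASS letters;
  **`road_jet_rows_of_locStencil`** — Form B, the literal's half from its socket `hS : ∀ n ≥ 2, LocStencil (S n) (Cs n) (δS n)` + the rate floor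
  `σV∕n ≤ δS n∕2` + ONE units inequality `16·Cs n·Zl 4 (δS n∕2)² ≤ uS` (leaf-01 `mass_blk_le_of_locStencil`).
* §4 **`exists_mass_tBw₁`**: per scale, the co-frame letter holds with SOME constant (`biLoc_tBw₁_rate` + `mass_le_of_biLoc`, `σ ≤ dB∕16`) — for
  per-scale consumers (`AbsMoment₂` rows); the m-uniform inequality stays displayed.
NOT HERE (honest): the W half (`hWs`∕`hWm` of `W2NInf` — leaf-03 g24 «COFRAME-MASS» M1–M3 + the open row «TB4-W CO-FRAME TABLE, m-UNIFORM MASS»); any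
count of `tBw₁`'s constant in `n`; the END; `TshotOf`.
Unit `b2b-balaban-beta-d1-formalise-leaf-01` (gen 24), D1 formalisation swarm leaf prover 01, road «BF-x»; INTENT «JET ROWS AT THE ROAD, V HALF» (journal).
-/

noncomputable section

open Finset
open scoped BigOperators
open Literature.MathematicalPhysics.QuantumFieldTheory.Balaban1983to89
open Literature.MathematicalPhysics.QuantumFieldTheory.Balaban1983to89.Beta
open B12Sec2to5 (l1 l1_nonneg)
open B5Hk163Strip (kappa163 kappa163_pos)
open B5Hk163Decay (MG163)
open B4TorusKernel (periodConst)
open ExpKernelCalculus (Site MKer BiLoc Zl Zl_nonneg)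
open OneStepResolventKernel (Fib LocStencil)
open OneStepKernelFamily (KInvStep vertexOfK)
open AffineAveraging (box toSite)
open Summit.QuantumFields.BalabanUV.Beta.AxialDressingRooted (coDressKBmAt)
open Summit.QuantumFields.BalabanUV.Beta.D1BFx.PackedKernelSplit (blk blk_tt blk_tf blk_ft blk_ff)
open Summit.QuantumFields.BalabanUV.Beta.D1BFx.PackedSortedBridges (embFF twistR twistR_inl twistR_inr embFF_inl_inr embFF_inr_inl embFF_inr_inr)
open Summit.QuantumFields.BalabanUV.Beta.D1BFx.TorusWeightWordTwisted (tBw₁)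
open Summit.QuantumFields.BalabanUV.Beta.D1BFx.TorusBondArrays (dB dB_pos)
open Summit.QuantumFields.BalabanUV.Beta.D1BFx.PackedCoframeWord (biLoc_tBw₁_rate)
open Summit.QuantumFields.BalabanUV.Beta.D1BFx.PackedNSideDictionary (SN SN_apply)
open Summit.QuantumFields.BalabanUV.Beta.D1BFx.PackedNSideReadout (blk_tt_SN)
open Summit.QuantumFields.BalabanUV.Beta.D1BFx.PackedColumnJetMass (mass_blk_vertexOfK_G₀_le)
open Summit.QuantumFields.BalabanUV.Beta.D1BFx.RestKernelSandwichLoc (mass_le_of_biLoc mass_blk_le_of_locStencil)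

namespace Summit.QuantumFields.BalabanUV.Beta.D1BFx.PackedRoadJetRows

/-! ## §1 The four blocks of the N-side stencil `SN m a S = twistR S + embFF (tBw₁ (m+1) a)` -/

section Blocks

variable (m : ℕ) (a : ℝ) (S : Fin 4 → (Fin 4 → ℤ) → MKer 4 (Fib 3)) (κ : Fin 4) (u : Fin 4 → ℤ)

/-- [our object] **THE mf BLOCK OF `SN`** is the mf block of `S` (field column: no sign; the embedded co-frame kernel is ff only). -/
theorem blk_ft_SN : blk (SN m a S κ u) false true = blk (S κ u) false true := by
  funext x z g f
  show SN m a S κ u x z (Sum.inr g) (Sum.inl f) = S κ u x z (Sum.inr g) (Sum.inl f)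
  rw [SN_apply]
  show twistR (S κ u) x z (Sum.inr g) (Sum.inl f) + embFF (tBw₁ (m + 1) a κ u) x z (Sum.inr g) (Sum.inl f) = _
  rw [twistR_inl, embFF_inr_inl, add_zero]

/-- [our object] **THE fm BLOCK OF `SN`** is MINUS the fm block of `S` (multiplier column: sign twist). -/
theorem blk_tf_SN : blk (SN m a S κ u) true false = -blk (S κ u) true false := by
  funext x z g f
  show SN m a S κ u x z (Sum.inl g) (Sum.inr f) = -(S κ u x z (Sum.inl g) (Sum.inr f))
  rw [SN_apply]
  show twistR (S κ u) x z (Sum.inl g) (Sum.inr f) + embFF (tBw₁ (m + 1) a κ u) x z (Sum.inl g) (Sum.inr f) = _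
  rw [twistR_inr, embFF_inl_inr, add_zero]

/-- [our object] **THE mm BLOCK OF `SN`** is MINUS the mm block of `S` (multiplier column: sign twist). -/
theorem blk_ff_SN : blk (SN m a S κ u) false false = -blk (S κ u) false false := by
  funext x z g f
  show SN m a S κ u x z (Sum.inr g) (Sum.inr f) = -(S κ u x z (Sum.inr g) (Sum.inr f))
  rw [SN_apply]
  show twistR (S κ u) x z (Sum.inr g) (Sum.inr f) + embFF (tBw₁ (m + 1) a κ u) x z (Sum.inr g) (Sum.inr f) = _
  rw [twistR_inr, embFF_inr_inr, add_zero]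

end Blocks

/-! ## §2 Masses: a negated kernel, a sum of two kernels, the blocks of `SN` -/

section Mass

variable {w : Site 4 × Site 4 → ℝ}

/-- [folklore] The WEIGHTED mass integrand of `−K` is that of `K` (weighted twin of leaf-03's plain `PackedCoframeSep.mass_neg_eq`). -/
theorem mass_integrand_neg (K : MKer 4 (Fin 4)) (w : Site 4 × Site 4 → ℝ) :
    (fun p : Site 4 × Site 4 => ∑ g, ∑ f, |(-K) p.1 p.2 g f| * w p) = fun p => ∑ g, ∑ f, |K p.1 p.2 g f| * w p := by
  funext p
  simp only [Pi.neg_apply, abs_neg]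

/-- [folklore] **THE WEIGHTED MASS OF A SUM OF TWO KERNELS** (any weight `w ≥ 0`; the σ-weighted twin of leaf-03's plain `PackedCoframeSep.mass_add_le`,
which is the case `w = 1`): summable, and `≤ mK + mL` on the two letters. -/
theorem mass_add_le {K L : MKer 4 (Fin 4)} (hw : ∀ p, 0 ≤ w p) {mK mL : ℝ}
    (hKs : Summable fun p : Site 4 × Site 4 => ∑ g, ∑ f, |K p.1 p.2 g f| * w p)
    (hKm : ∑' p : Site 4 × Site 4, ∑ g, ∑ f, |K p.1 p.2 g f| * w p ≤ mK)
    (hLs : Summable fun p : Site 4 × Site 4 => ∑ g, ∑ f, |L p.1 p.2 g f| * w p)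
    (hLm : ∑' p : Site 4 × Site 4, ∑ g, ∑ f, |L p.1 p.2 g f| * w p ≤ mL) :
    (Summable fun p : Site 4 × Site 4 => ∑ g, ∑ f, |(K + L) p.1 p.2 g f| * w p) ∧
      ∑' p : Site 4 × Site 4, ∑ g, ∑ f, |(K + L) p.1 p.2 g f| * w p ≤ mK + mL := by
  have hpt : ∀ p : Site 4 × Site 4, ∑ g, ∑ f, |(K + L) p.1 p.2 g f| * w p
      ≤ (∑ g, ∑ f, |K p.1 p.2 g f| * w p) + ∑ g, ∑ f, |L p.1 p.2 g f| * w p := fun p => by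
    rw [← Finset.sum_add_distrib]
    refine Finset.sum_le_sum fun g _ => ?_
    rw [← Finset.sum_add_distrib]
    refine Finset.sum_le_sum fun f _ => ?_
    rw [← add_mul]
    exact mul_le_mul_of_nonneg_right (abs_add_le (K p.1 p.2 g f) (L p.1 p.2 g f)) (hw p)
  have h0 : ∀ p : Site 4 × Site 4, 0 ≤ ∑ g, ∑ f, |(K + L) p.1 p.2 g f| * w p := fun p =>
    Finset.sum_nonneg fun g _ => Finset.sum_nonneg fun f _ => mul_nonneg (abs_nonneg _) (hw p)
  have hs : Summable fun p : Site 4 × Site 4 => ∑ g, ∑ f, |(K + L) p.1 p.2 g f| * w p :=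
    Summable.of_nonneg_of_le h0 hpt (hKs.add hLs)
  refine ⟨hs, ?_⟩
  calc ∑' p : Site 4 × Site 4, ∑ g, ∑ f, |(K + L) p.1 p.2 g f| * w p
      ≤ ∑' p : Site 4 × Site 4, ((∑ g, ∑ f, |K p.1 p.2 g f| * w p) + ∑ g, ∑ f, |L p.1 p.2 g f| * w p) :=
        Summable.tsum_le_tsum hpt hs (hKs.add hLs)
    _ = (∑' p : Site 4 × Site 4, ∑ g, ∑ f, |K p.1 p.2 g f| * w p) + ∑' p : Site 4 × Site 4, ∑ g, ∑ f, |L p.1 p.2 g f| * w p :=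
        hKs.tsum_add hLs
    _ ≤ mK + mL := add_le_add hKm hLm

variable (m : ℕ) (a : ℝ) (S : Fin 4 → (Fin 4 → ℤ) → MKer 4 (Fib 3)) (κ : Fin 4) (u : Fin 4 → ℤ)

/-- [folklore] **THE BLOCK MASSES OF `SN m a S κ u` ON TWO LETTERS**: for a nonnegative weight `w`, if every block of `S κ u` has summable `w`-mass
`≤ mS j k` and `tBw₁ (m+1) a κ u` has summable `w`-mass `≤ mT`, then every block of `SN m a S κ u` has summable `w`-mass
`≤ mS j k + (bif (j && k) then mT else 0)` (the co-frame kernel sits in the ff block only; the sign twist does not change a mass). -/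
theorem mass_blk_SN_le (hw : ∀ p, 0 ≤ w p) {mS : Bool → Bool → ℝ} {mT : ℝ}
    (hSs : ∀ j k, Summable fun p : Site 4 × Site 4 => ∑ g, ∑ f, |blk (S κ u) j k p.1 p.2 g f| * w p)
    (hSm : ∀ j k, ∑' p : Site 4 × Site 4, ∑ g, ∑ f, |blk (S κ u) j k p.1 p.2 g f| * w p ≤ mS j k)
    (hTs : Summable fun p : Site 4 × Site 4 => ∑ g, ∑ f, |tBw₁ (m + 1) a κ u p.1 p.2 g f| * w p)
    (hTm : ∑' p : Site 4 × Site 4, ∑ g, ∑ f, |tBw₁ (m + 1) a κ u p.1 p.2 g f| * w p ≤ mT) (j k : Bool) :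
    (Summable fun p : Site 4 × Site 4 => ∑ g, ∑ f, |blk (SN m a S κ u) j k p.1 p.2 g f| * w p) ∧
      ∑' p : Site 4 × Site 4, ∑ g, ∑ f, |blk (SN m a S κ u) j k p.1 p.2 g f| * w p ≤ mS j k + (bif (j && k) then mT else 0) := by
  cases j <;> cases k
  · rw [blk_ff_SN, mass_integrand_neg]
    exact ⟨hSs false false, by simpa using hSm false false⟩
  · rw [blk_ft_SN]
    exact ⟨hSs false true, by simpa using hSm false true⟩
  · rw [blk_tf_SN, mass_integrand_neg]
    exact ⟨hSs true false, by simpa using hSm true false⟩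
  · rw [blk_tt_SN]
    simpa using mass_add_le hw (hSs true true) (hSm true true) hTs hTm

end Mass

/-! ## §3 The road's first-jet rows -/

section Road

/-- [folklore] **ONE SCALE, IN «G0-JET-MASS» CURRENCY**: for an in-block root `r`, a rate `0 ≤ σ ≤ κ′∕(16n)` (`n = m+1`, `κ′ = kappa163 4∕4`), a literal
stencil family `S` whose blocks have `u`-centred `σ`-weighted masses `≤ mS j k`, and the co-frame first bond kernels `tBw₁ n a κ u` with `u`-centred
`σ`-weighted masses `≤ mT`: every block of the road's packed first jet `vertexOfK G₀ n (SN m a S) ρ y` has summable `n•y`-centred `σ`-weighted mass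
`≤ 4·C_{G₀}·(1 + 16∕κ′)⁴·(mS j k + [tt]·mT)` — gan24-leaf-05's `mass_blk_vertexOfK_G₀_le` at the pack `SN m a S` (power `n⁰`). -/
theorem road_jet_mass_le (m : ℕ) {a : ℝ} {r : Fin (3 + 1) → ℕ} (hr : r ∈ box (3 + 1) (m + 1)) {S : Fin 4 → (Fin 4 → ℤ) → MKer 4 (Fib 3)}
    {σ : ℝ} (hσ0 : 0 ≤ σ) (hσ : σ ≤ kappa163 4 / 4 / (16 * ((m + 1 : ℕ) : ℝ))) {mS : Bool → Bool → ℝ} {mT : ℝ}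
    (hSs : ∀ κ u j k, Summable fun p : Site 4 × Site 4 =>
      ∑ g, ∑ f, |blk (S κ u) j k p.1 p.2 g f| * Real.exp (σ * (l1 (p.1 - u) + l1 (p.2 - u))))
    (hSm : ∀ κ u j k, ∑' p : Site 4 × Site 4,
      ∑ g, ∑ f, |blk (S κ u) j k p.1 p.2 g f| * Real.exp (σ * (l1 (p.1 - u) + l1 (p.2 - u))) ≤ mS j k)
    (hTs : ∀ κ u, Summable fun p : Site 4 × Site 4 =>
      ∑ g, ∑ f, |tBw₁ (m + 1) a κ u p.1 p.2 g f| * Real.exp (σ * (l1 (p.1 - u) + l1 (p.2 - u))))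
    (hTm : ∀ κ u, ∑' p : Site 4 × Site 4,
      ∑ g, ∑ f, |tBw₁ (m + 1) a κ u p.1 p.2 g f| * Real.exp (σ * (l1 (p.1 - u) + l1 (p.2 - u))) ≤ mT)
    (ρ : Fin (3 + 1)) (y : Fin (3 + 1) → ℤ) (j k : Bool) :
    (Summable fun p : Site 4 × Site 4 => ∑ g, ∑ f,
        |blk (vertexOfK (coDressKBmAt (toSite r) (m + 1) (KInvStep (d := 3) (m + 1) 0)) (m + 1) (SN m a S) ρ y) j k p.1 p.2 g f|
          * Real.exp (σ * (l1 (p.1 - ((m + 1 : ℕ) : ℤ) • y) + l1 (p.2 - ((m + 1 : ℕ) : ℤ) • y)))) ∧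
      ∑' p : Site 4 × Site 4, ∑ g, ∑ f,
          |blk (vertexOfK (coDressKBmAt (toSite r) (m + 1) (KInvStep (d := 3) (m + 1) 0)) (m + 1) (SN m a S) ρ y) j k p.1 p.2 g f|
            * Real.exp (σ * (l1 (p.1 - ((m + 1 : ℕ) : ℤ) • y) + l1 (p.2 - ((m + 1 : ℕ) : ℤ) • y)))
        ≤ 4 * ((MG163 4 * periodConst (kappa163 4) 3) * (1 + 8 * (1 + Real.exp (kappa163 4 / 4))) * Real.exp (kappa163 4 / 4))
            * (1 + 16 / (kappa163 4 / 4)) ^ 4 * (mS j k + (bif (j && k) then mT else 0)) :=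
  mass_blk_vertexOfK_G₀_le m hr (S := SN m a S) (mS := fun j k => mS j k + (bif (j && k) then mT else 0)) hσ0 hσ
    (fun κ u j k => (mass_blk_SN_le m a S κ u (fun _ => (Real.exp_pos _).le) (hSs κ u) (hSm κ u) (hTs κ u) (hTm κ u) j k).1)
    (fun κ u j k => (mass_blk_SN_le m a S κ u (fun _ => (Real.exp_pos _).le) (hSs κ u) (hSm κ u) (hTs κ u) (hTm κ u) j k).2) ρ y j k

/-- [folklore] **«JET ROWS AT THE ROAD, V HALF» — FORM A (m-uniform MASS letters displayed).**  For the road's per-scale in-block roots `r n` and literal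
first-derivative stencil families `S n`, one n-free rate `0 < σV ≤ κ′∕16`, and the two DISPLAYED m-uniform letters — the literal's: every block of
`S (m+1) κ u` has `u`-centred `σV∕(m+1)`-weighted mass `≤ mS j k`; the co-frame's (OPEN (II)-row «TB4-W CO-FRAME FIRST JET, m-UNIFORM MASS»): `tBw₁ (m+1) a κ u`
has `u`-centred `σV∕(m+1)`-weighted mass `≤ mT` — at every `m ≥ 1`: EXACTLY the OWNER's 12b ∕ 13 binders `hVs`∕`hVm` (restricted to `m ≥ 1`, as
`RestKernelSlotRowsTwo` consumes them) with `mV j k := 4·C_{G₀}·(1 + 16∕κ′)⁴·(mS j k + [tt]·mT)`. -/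
theorem road_jet_rows {a : ℝ} {r : ℕ → Fin (3 + 1) → ℕ} (hr : ∀ m : ℕ, r (m + 1) ∈ box (3 + 1) (m + 1))
    {S : ℕ → Fin 4 → (Fin 4 → ℤ) → MKer 4 (Fib 3)} {σV : ℝ} (hσV0 : 0 ≤ σV) (hσVκ : σV ≤ kappa163 4 / 4 / 16)
    {mS : Bool → Bool → ℝ} {mT : ℝ}
    (hSs : ∀ (m : ℕ), 1 ≤ m → ∀ (κ : Fin 4) (u : Fin 4 → ℤ) (j k : Bool), Summable fun p : Site 4 × Site 4 =>
      ∑ g, ∑ f, |blk (S (m + 1) κ u) j k p.1 p.2 g f| * Real.exp (σV / ((m + 1 : ℕ) : ℝ) * (l1 (p.1 - u) + l1 (p.2 - u))))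
    (hSm : ∀ (m : ℕ), 1 ≤ m → ∀ (κ : Fin 4) (u : Fin 4 → ℤ) (j k : Bool), ∑' p : Site 4 × Site 4,
      ∑ g, ∑ f, |blk (S (m + 1) κ u) j k p.1 p.2 g f| * Real.exp (σV / ((m + 1 : ℕ) : ℝ) * (l1 (p.1 - u) + l1 (p.2 - u))) ≤ mS j k)
    (hTs : ∀ (m : ℕ), 1 ≤ m → ∀ (κ : Fin 4) (u : Fin 4 → ℤ), Summable fun p : Site 4 × Site 4 =>
      ∑ g, ∑ f, |tBw₁ (m + 1) a κ u p.1 p.2 g f| * Real.exp (σV / ((m + 1 : ℕ) : ℝ) * (l1 (p.1 - u) + l1 (p.2 - u))))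
    (hTm : ∀ (m : ℕ), 1 ≤ m → ∀ (κ : Fin 4) (u : Fin 4 → ℤ), ∑' p : Site 4 × Site 4,
      ∑ g, ∑ f, |tBw₁ (m + 1) a κ u p.1 p.2 g f| * Real.exp (σV / ((m + 1 : ℕ) : ℝ) * (l1 (p.1 - u) + l1 (p.2 - u))) ≤ mT) :
    (∀ (m : ℕ), 1 ≤ m → ∀ (ρ : Fin 4) (y : Site 4) (j k : Bool), Summable fun q : Site 4 × Site 4 => ∑ g, ∑ f,
      |blk (vertexOfK (coDressKBmAt (toSite (r (m + 1))) (m + 1) (KInvStep (d := 3) (m + 1) 0)) (m + 1) (SN m a (S (m + 1))) ρ y) j k q.1 q.2 g f|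
        * Real.exp (σV / ((m + 1 : ℕ) : ℝ) * (l1 (q.1 - ((m + 1 : ℕ) : ℤ) • y) + l1 (q.2 - ((m + 1 : ℕ) : ℤ) • y)))) ∧
    (∀ (m : ℕ), 1 ≤ m → ∀ (ρ : Fin 4) (y : Site 4) (j k : Bool), ∑' q : Site 4 × Site 4, ∑ g, ∑ f,
      |blk (vertexOfK (coDressKBmAt (toSite (r (m + 1))) (m + 1) (KInvStep (d := 3) (m + 1) 0)) (m + 1) (SN m a (S (m + 1))) ρ y) j k q.1 q.2 g f|
        * Real.exp (σV / ((m + 1 : ℕ) : ℝ) * (l1 (q.1 - ((m + 1 : ℕ) : ℤ) • y) + l1 (q.2 - ((m + 1 : ℕ) : ℤ) • y)))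
      ≤ 4 * ((MG163 4 * periodConst (kappa163 4) 3) * (1 + 8 * (1 + Real.exp (kappa163 4 / 4))) * Real.exp (kappa163 4 / 4))
            * (1 + 16 / (kappa163 4 / 4)) ^ 4 * (mS j k + (bif (j && k) then mT else 0))) := by
  have hrate : ∀ m : ℕ, 0 ≤ σV / ((m + 1 : ℕ) : ℝ) ∧ σV / ((m + 1 : ℕ) : ℝ) ≤ kappa163 4 / 4 / (16 * ((m + 1 : ℕ) : ℝ)) := fun m => by
    have hn0 : (0 : ℝ) < ((m + 1 : ℕ) : ℝ) := by exact_mod_cast Nat.succ_pos m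
    refine ⟨div_nonneg hσV0 hn0.le, ?_⟩
    calc σV / ((m + 1 : ℕ) : ℝ) ≤ kappa163 4 / 4 / 16 / ((m + 1 : ℕ) : ℝ) := div_le_div_of_nonneg_right hσVκ hn0.le
      _ = kappa163 4 / 4 / (16 * ((m + 1 : ℕ) : ℝ)) := div_div _ _ _
  exact ⟨fun m hm ρ y j k => (road_jet_mass_le m (hr m) (hrate m).1 (hrate m).2 (hSs m hm) (hSm m hm) (hTs m hm) (hTm m hm) ρ y j k).1,
    fun m hm ρ y j k => (road_jet_mass_le m (hr m) (hrate m).1 (hrate m).2 (hSs m hm) (hSm m hm) (hTs m hm) (hTm m hm) ρ y j k).2⟩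

/-- [folklore] **«JET ROWS AT THE ROAD, V HALF» — FORM B (the literal's half from its socket + ONE units inequality).**  As Form A, with the
literal's mass letter DERIVED from the END's own socket `hS : ∀ n ≥ 2, LocStencil (S n) (Cs n) (δS n)` (`0 ≤ Cs n`, `0 < δS n`), the block-scale rate
floor `σV∕n ≤ δS n∕2` and ONE displayed m-uniform UNITS inequality `16·Cs n·Zl 4 (δS n∕2)² ≤ uS` (sup × localisation volume², leaf-01
`mass_blk_le_of_locStencil`): `mV j k := 4·C_{G₀}·(1 + 16∕κ′)⁴·(uS + [tt]·mT)`.  (Count-lossy by construction — the mass letter of Form A is the primitive.) -/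
theorem road_jet_rows_of_locStencil {a : ℝ} {r : ℕ → Fin (3 + 1) → ℕ} (hr : ∀ m : ℕ, r (m + 1) ∈ box (3 + 1) (m + 1))
    {S : ℕ → Fin 4 → (Fin 4 → ℤ) → MKer 4 (Fib 3)} {Cs δS : ℕ → ℝ} (hS : ∀ n : ℕ, 2 ≤ n → LocStencil (S n) (Cs n) (δS n))
    (hCs : ∀ n, 0 ≤ Cs n) (hδS : ∀ n, 0 < δS n)
    {σV : ℝ} (hσV0 : 0 ≤ σV) (hσVκ : σV ≤ kappa163 4 / 4 / 16) (hσVS : ∀ n : ℕ, 2 ≤ n → σV / (n : ℝ) ≤ δS n / 2)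
    {uS : ℝ} (huS : ∀ n : ℕ, 2 ≤ n → 16 * Cs n * Zl 4 (δS n / 2) ^ 2 ≤ uS) {mT : ℝ}
    (hTs : ∀ (m : ℕ), 1 ≤ m → ∀ (κ : Fin 4) (u : Fin 4 → ℤ), Summable fun p : Site 4 × Site 4 =>
      ∑ g, ∑ f, |tBw₁ (m + 1) a κ u p.1 p.2 g f| * Real.exp (σV / ((m + 1 : ℕ) : ℝ) * (l1 (p.1 - u) + l1 (p.2 - u))))
    (hTm : ∀ (m : ℕ), 1 ≤ m → ∀ (κ : Fin 4) (u : Fin 4 → ℤ), ∑' p : Site 4 × Site 4,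
      ∑ g, ∑ f, |tBw₁ (m + 1) a κ u p.1 p.2 g f| * Real.exp (σV / ((m + 1 : ℕ) : ℝ) * (l1 (p.1 - u) + l1 (p.2 - u))) ≤ mT) :
    (∀ (m : ℕ), 1 ≤ m → ∀ (ρ : Fin 4) (y : Site 4) (j k : Bool), Summable fun q : Site 4 × Site 4 => ∑ g, ∑ f,
      |blk (vertexOfK (coDressKBmAt (toSite (r (m + 1))) (m + 1) (KInvStep (d := 3) (m + 1) 0)) (m + 1) (SN m a (S (m + 1))) ρ y) j k q.1 q.2 g f|
        * Real.exp (σV / ((m + 1 : ℕ) : ℝ) * (l1 (q.1 - ((m + 1 : ℕ) : ℤ) • y) + l1 (q.2 - ((m + 1 : ℕ) : ℤ) • y)))) ∧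
    (∀ (m : ℕ), 1 ≤ m → ∀ (ρ : Fin 4) (y : Site 4) (j k : Bool), ∑' q : Site 4 × Site 4, ∑ g, ∑ f,
      |blk (vertexOfK (coDressKBmAt (toSite (r (m + 1))) (m + 1) (KInvStep (d := 3) (m + 1) 0)) (m + 1) (SN m a (S (m + 1))) ρ y) j k q.1 q.2 g f|
        * Real.exp (σV / ((m + 1 : ℕ) : ℝ) * (l1 (q.1 - ((m + 1 : ℕ) : ℤ) • y) + l1 (q.2 - ((m + 1 : ℕ) : ℤ) • y)))
      ≤ 4 * ((MG163 4 * periodConst (kappa163 4) 3) * (1 + 8 * (1 + Real.exp (kappa163 4 / 4))) * Real.exp (kappa163 4 / 4))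
            * (1 + 16 / (kappa163 4 / 4)) ^ 4 * (uS + (bif (j && k) then mT else 0))) := by
  have hlit : ∀ (m : ℕ), 1 ≤ m → ∀ (κ : Fin 4) (u : Fin 4 → ℤ) (j k : Bool),
      (Summable fun p : Site 4 × Site 4 =>
        ∑ g, ∑ f, |blk (S (m + 1) κ u) j k p.1 p.2 g f| * Real.exp (σV / ((m + 1 : ℕ) : ℝ) * (l1 (p.1 - u) + l1 (p.2 - u)))) ∧
      ∑' p : Site 4 × Site 4,
        ∑ g, ∑ f, |blk (S (m + 1) κ u) j k p.1 p.2 g f| * Real.exp (σV / ((m + 1 : ℕ) : ℝ) * (l1 (p.1 - u) + l1 (p.2 - u))) ≤ uS := by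
    intro m hm κ u j k
    have hn : 2 ≤ m + 1 := by omega
    have h := mass_blk_le_of_locStencil (hS (m + 1) hn) (hCs (m + 1)) (hδS (m + 1)) (hσVS (m + 1) hn) κ u j k
    exact ⟨h.1, h.2.trans (huS (m + 1) hn)⟩
  exact road_jet_rows (mS := fun _ _ => uS) hr hσV0 hσVκ (fun m hm κ u j k => (hlit m hm κ u j k).1) (fun m hm κ u j k => (hlit m hm κ u j k).2) hTs hTm

end Road

/-! ## §4 Per scale, the co-frame letter holds with SOME constant -/

section PerScale

/-- [folklore] **PER SCALE, THE CO-FRAME FIRST BOND KERNEL HAS A FINITE WEIGHTED MASS**: for `σ ≤ dB (m+1) a∕16` there is `mT ≥ 0` (NOT displayed, NOT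
counted in `n` — FILE A's `biLoc_tBw₁_rate` constant × `16·Zl 4 (dB∕16)²`) with `Σ'|tBw₁ (m+1) a κ u|·e^{σ(|·−u|₁+|·−u|₁)} ≤ mT` for every bond.  For the
per-scale consumers (`AbsMoment₂` rows); the m-UNIFORM inequality is the open (II)-row «TB4-W CO-FRAME FIRST JET, m-UNIFORM MASS» and stays displayed. -/
theorem exists_mass_tBw₁ (m : ℕ) {a : ℝ} (ha : 0 < a) {σ : ℝ} (hσ : σ ≤ dB (m + 1) a / 16) :
    ∃ mT : ℝ, 0 ≤ mT ∧ ∀ (κ : Fin 4) (u : Fin 4 → ℤ),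
      (Summable fun p : Site 4 × Site 4 =>
        ∑ g, ∑ f, |tBw₁ (m + 1) a κ u p.1 p.2 g f| * Real.exp (σ * (l1 (p.1 - u) + l1 (p.2 - u)))) ∧
      ∑' p : Site 4 × Site 4,
        ∑ g, ∑ f, |tBw₁ (m + 1) a κ u p.1 p.2 g f| * Real.exp (σ * (l1 (p.1 - u) + l1 (p.2 - u))) ≤ mT := by
  obtain ⟨C, hC, hB⟩ := biLoc_tBw₁_rate m ha (le_refl (dB (m + 1) a / 8))
  have hδ : 0 < dB (m + 1) a / 8 := by have := dB_pos (m + 1) a ha; positivity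
  have hZ : 0 ≤ Zl 4 (dB (m + 1) a / 8 / 2) := Zl_nonneg (half_pos hδ)
  refine ⟨(Fintype.card (Fin 4) : ℝ) ^ 2 * C * Zl 4 (dB (m + 1) a / 8 / 2) ^ 2, by positivity, fun κ u => ?_⟩
  exact mass_le_of_biLoc (hB κ u) hC hδ (by linarith)

end PerScale

end Summit.QuantumFields.BalabanUV.Beta.D1BFx.PackedRoadJetRows

end
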